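import Summits.ValiantsHypothesis.ValiantsHypothesis.Theorems.SymPencilPerFourInnerRankPureGramNuTreeH
import Summits.ValiantsHypothesis.ValiantsHypothesis.Theorems.SymPencilPerFourInnerRankPureGramCount

/-!
# Route `SymPencil` — inner rank of the `2 | 2` row split of `per_4`, the pure Gram problem P1:
# STEP (2), the `ν`-side trichotomy for designs
# (`--supports` stmt-ValiantsHypothesis-5674 `SdcSuperquadratic`; (8,8) column; rung currency only)

**Theorem** (`nu_side_trichotomy`).  Let `Σ_r c_r t_r((a,b),(y₂,y₃))² = per (a; b; y₂; y₃)` over a field of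
characteristic `0` (`hJ`; purity is NOT needed here), `n_{bk} = (t_r((0,e_b),(e_k,0)))_r ∈ K^ι` and
`⟨x, x'⟩ = Σ_r c_r x_r x'_r`.  Then one of:
1. (`A ≥ 3`) three kernel combinations `x_i = Σ ξ^i_{bk} n_{bk}` (`ξ^i` diagonal-plus-antisymmetric) and
   three test vectors `g_{i'}` with `det ⟨x_i, g_{i'}⟩ ≠ 0` — exactly the `ν`-half of the hypotheses of
   `…PureGramCount.false_of_allX_of_kernel_three_three` (STEP (1));
2. (`A = 0`) all `⟨n_{bk}, n_{b'k'}⟩` vanish — the hypothesis of `…PureGramCount.false_of_allX_of_nGram_zero`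
   (STEP (3));
3. (the three lines) there are `τ ≠ 0` and one of the three signed anti-diagonal `6 × 6` sign patterns `M`
   (classes `+++`, `++-`, `+--` of the all-ones complementary form `c₀`) with
   `⟨n_{bk}, n_{b'k'}⟩ = τ · ε(b,b') ε(k,k') M[{b,b'}][{k,k'}]` (`ε` the sign of the transposition, pairs
   indexed `01,02,03,12,13,23`) — the input of STEPS (4)–(5) (`…PureGramLinePPP*`).
Proof: the identity gives the relations `⟨n_{bk}, n_{bk'}⟩ = 0 = ⟨n_{bk}, n_{b'k}⟩` and antisymmetry in
`b ↔ b'`, `k ↔ k'`, so the Gram table is determined by its 36 canonical values; the abstract case tree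
`…PureGramNuTree.nuTree_0` (151 nodes of `3 × 3` product minors, from `pub/val-lit/lmr/p8g14-P1/certtree3.py`)
is instantiated with these values.  Honest framing: a lemma toward the kernel proof of P1 (pure `per_4`-designs
need twelve squares); the cells `(8,8,10)`, `(8,8,11)`, the window `27 ≤ sdc(per_4) ≤ 29`, the crux
`SdcSuperquadratic` and `VP ≠ VNP` are untouched. No definitions, no named facts. [folklore]
-/

noncomputable section

-- single-conjunct layout: Sub = Summit, duplicated namespace component intended
set_option linter.dupNamespace false

namespace Summit.ValiantsHypothesis.ValiantsHypothesis.Theorems.SymPencilPerFourInnerRankPureGramNuSide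

open Matrix Finset
open Summit.ValiantsHypothesis.ValiantsHypothesis.Theorems.SymPencilPerFourInnerRankRows
open Summit.ValiantsHypothesis.ValiantsHypothesis.Theorems.SymPencilPerFourInnerRankTenFamily
open Summit.ValiantsHypothesis.ValiantsHypothesis.Theorems.SymPencilPerFourInnerRankPureGramNuTree

variable {K : Type*} [Field K] [CharZero K] {ι : Type*} [Fintype ι]

/-- **STEP (2) of P1: the `ν`-side trichotomy.**  See the module docstring. [folklore] -/
theorem nu_side_trichotomy (c : ι → K)
    (t : ι → (((Fin 4 → K) × (Fin 4 → K)) →ₗ[K] ((Fin 4 → K) × (Fin 4 → K)) →ₗ[K] K))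
    (hJ : ∀ a b y₂ y₃ : Fin 4 → K,
      ∑ r, c r * (t r (a, b) (y₂, y₃)) ^ 2 = (Matrix.of ![a, b, y₂, y₃]).permanent) :
    (∃ ξ : Fin 3 → Fin 4 → Fin 4 → K, (∀ i b k, b ≠ k → ξ i b k = -ξ i k b) ∧
      ∃ g : Fin 3 → ι → K, (Matrix.of fun i i' : Fin 3 => ∑ r, c r *
        (∑ b, ∑ k, ξ i b k * t r (0, Pi.single b 1) (Pi.single k 1, 0)) * g i' r).det ≠ 0) ∨
    (∀ b k b' k' : Fin 4, ∑ r, c r * t r (0, Pi.single b 1) (Pi.single k 1, 0) *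
        t r (0, Pi.single b' 1) (Pi.single k' 1, 0) = 0) ∨
    (∃ τ : K, τ ≠ 0 ∧ ∃ M : Matrix (Fin 6) (Fin 6) K,
      (M = !![0, 0, 0, 0, 0, 1; 0, 0, 0, 0, 1, 0; 0, 0, 0, 1, 0, 0; 0, 0, 1, 0, 0, 0; 0, 1, 0, 0, 0, 0;
          1, 0, 0, 0, 0, 0] ∨
       M = !![0, 0, 0, 0, 0, 1; 0, 0, 0, 0, 1, 0; 0, 0, 0, -1, 0, 0; 0, 0, -1, 0, 0, 0; 0, 1, 0, 0, 0, 0;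
          1, 0, 0, 0, 0, 0] ∨
       M = !![0, 0, 0, 0, 0, 1; 0, 0, 0, 0, -1, 0; 0, 0, 0, -1, 0, 0; 0, 0, -1, 0, 0, 0; 0, -1, 0, 0, 0, 0;
          1, 0, 0, 0, 0, 0]) ∧
      ∀ b k b' k' : Fin 4, ∑ r, c r * t r (0, Pi.single b 1) (Pi.single k 1, 0) *
          t r (0, Pi.single b' 1) (Pi.single k' 1, 0) =
        τ * ((![![(0 : K), 1, 1, 1], ![-1, 0, 1, 1], ![-1, -1, 0, 1], ![-1, -1, -1, 0]] b b') *
          (![![(0 : K), 1, 1, 1], ![-1, 0, 1, 1], ![-1, -1, 0, 1], ![-1, -1, -1, 0]] k k') *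
          M (![![(0 : Fin 6), 0, 1, 2], ![0, 0, 3, 4], ![1, 3, 0, 5], ![2, 4, 5, 0]] b b')
            (![![(0 : Fin 6), 0, 1, 2], ![0, 0, 3, 4], ![1, 3, 0, 5], ![2, 4, 5, 0]] k k'))) := by
  -- general relations from the identity alone (cf. `…InnerRankPureSymm`)
  have hd : ∀ bb y y' : Fin 4 → K,
      ∑ r, c r * t r (0, bb) (y, 0) * t r (0, bb) (y', 0) = 0 := fun bb y y' => by
    have h' := polar c t hJ 0 bb y 0 y' 0
    rw [per_zero_row₀, per_zero_row₀, add_zero] at h'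
    exact (mul_eq_zero.1 h').resolve_left two_ne_zero
  have hsplit : ∀ (b b' : Fin 4 → K) (y : (Fin 4 → K) × (Fin 4 → K)) r,
      t r (0, b + b') y = t r (0, b) y + t r (0, b') y := fun b b' y r => by
    rw [← LinearMap.add_apply, ← map_add]; simp
  have isoV : ∀ b b' y y' : Fin 4 → K,
      ∑ r, c r * t r (0, b) (y, 0) * t r (0, b') (y', 0) +
        ∑ r, c r * t r (0, b') (y, 0) * t r (0, b) (y', 0) = 0 := by
    intro b b' y y'
    have h := hd (b + b') y y'
    simp_rw [hsplit] at h
    have h1 := hd b y y'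
    have h2 := hd b' y y'
    have hexp : ∑ r, c r * (t r (0, b) (y, 0) + t r (0, b') (y, 0)) *
        (t r (0, b) (y', 0) + t r (0, b') (y', 0)) =
        ∑ r, c r * t r (0, b) (y, 0) * t r (0, b) (y', 0) +
        ∑ r, c r * t r (0, b) (y, 0) * t r (0, b') (y', 0) +
        ∑ r, c r * t r (0, b') (y, 0) * t r (0, b) (y', 0) +
        ∑ r, c r * t r (0, b') (y, 0) * t r (0, b') (y', 0) := by
      rw [← Finset.sum_add_distrib, ← Finset.sum_add_distrib, ← Finset.sum_add_distrib]
      exact Finset.sum_congr rfl fun r _ => by ring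
    rw [hexp] at h
    linear_combination h - h1 - h2
  -- name the vectors `n_{bk}` and the Gram values `G b k b' k' = ⟨n_{bk}, n_{b'k'}⟩`
  obtain ⟨n, hn⟩ : ∃ n : Fin 4 → Fin 4 → ι → K,
      ∀ j k r, t r (0, Pi.single j 1) (Pi.single k 1, 0) = n j k r := ⟨_, fun _ _ _ => rfl⟩
  obtain ⟨G, hG⟩ : ∃ G : Fin 4 → Fin 4 → Fin 4 → Fin 4 → K,
      ∀ b k b' k', ∑ r, c r * n b k r * n b' k' r = G b k b' k' := ⟨_, fun _ _ _ _ => rfl⟩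
  simp only [hn, hG]
  -- the four relation families
  have zb : ∀ b k k' : Fin 4, G b k b k' = 0 := fun b k k' => by
    rw [← hG]; simp only [← hn]; exact hd _ _ _
  have ab : ∀ b k b' k' : Fin 4, b' < b → G b k b' k' = -G b' k b k' := fun b k b' k' _ => by
    rw [← hG, ← hG]; simp only [← hn]
    linear_combination isoV (Pi.single b 1) (Pi.single b' 1) (Pi.single k 1) (Pi.single k' 1)
  have zk : ∀ b k b' : Fin 4, G b k b' k = 0 := fun b k b' => by
    rw [← hG]; simp only [← hn]
    have h := isoV (Pi.single b 1) (Pi.single b' 1) (Pi.single k 1) (Pi.single k 1)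
    have hs : ∑ r, c r * t r (0, Pi.single b' 1) (Pi.single k 1, 0) *
        t r (0, Pi.single b 1) (Pi.single k 1, 0) =
        ∑ r, c r * t r (0, Pi.single b 1) (Pi.single k 1, 0) *
        t r (0, Pi.single b' 1) (Pi.single k 1, 0) := Finset.sum_congr rfl fun r _ => by ring
    linear_combination (h - hs) / 2
  have ak : ∀ b k b' k' : Fin 4, k' < k → G b k b' k' = -G b k' b' k := fun b k b' k' _ => by
    rw [← hG, ← hG]; simp only [← hn]
    have h := isoV (Pi.single b 1) (Pi.single b' 1) (Pi.single k 1) (Pi.single k' 1)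
    have hs : ∑ r, c r * t r (0, Pi.single b' 1) (Pi.single k 1, 0) *
        t r (0, Pi.single b 1) (Pi.single k' 1, 0) =
        ∑ r, c r * t r (0, Pi.single b 1) (Pi.single k' 1, 0) *
        t r (0, Pi.single b' 1) (Pi.single k 1, 0) := Finset.sum_congr rfl fun r _ => by ring
    linear_combination h - hs
  -- the 36 canonical values `C S T = G p r q s` (`S = {p<q}`, `T = {r<s}`) and the table identity
  obtain ⟨C, hC⟩ : ∃ C : Fin 6 → Fin 6 → K, ∀ S T, C S T =
      G (![0, 0, 0, 1, 1, 2] S) (![0, 0, 0, 1, 1, 2] T) (![1, 2, 3, 2, 3, 3] S) (![1, 2, 3, 2, 3, 3] T) :=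
    ⟨_, fun _ _ => rfl⟩
  have wi1 : ∀ b b' : Fin 4, b < b' →
      (![0, 0, 0, 1, 1, 2] : Fin 6 → Fin 4)
        ((![![(0 : Fin 6), 0, 1, 2], ![0, 0, 3, 4], ![1, 3, 0, 5], ![2, 4, 5, 0]] b b')) = b := by
    intro b b' h
    fin_cases b <;> fin_cases b' <;> simp at h ⊢
  have wi2 : ∀ b b' : Fin 4, b < b' →
      (![1, 2, 3, 2, 3, 3] : Fin 6 → Fin 4)
        ((![![(0 : Fin 6), 0, 1, 2], ![0, 0, 3, 4], ![1, 3, 0, 5], ![2, 4, 5, 0]] b b')) = b' := by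
    intro b b' h
    fin_cases b <;> fin_cases b' <;> simp at h ⊢
  have wiS : ∀ b b' : Fin 4,
      (![![(0 : Fin 6), 0, 1, 2], ![0, 0, 3, 4], ![1, 3, 0, 5], ![2, 4, 5, 0]] b b') =
      (![![(0 : Fin 6), 0, 1, 2], ![0, 0, 3, 4], ![1, 3, 0, 5], ![2, 4, 5, 0]] b' b) := by
    intro b b'
    fin_cases b <;> fin_cases b' <;> simp
  have ws1 : ∀ b b' : Fin 4, b < b' →
      (![![(0 : K), 1, 1, 1], ![-1, 0, 1, 1], ![-1, -1, 0, 1], ![-1, -1, -1, 0]] b b') = 1 := by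
    intro b b' h
    fin_cases b <;> fin_cases b' <;> simp at h ⊢
  have wsA : ∀ b b' : Fin 4,
      (![![(0 : K), 1, 1, 1], ![-1, 0, 1, 1], ![-1, -1, 0, 1], ![-1, -1, -1, 0]] b b') =
      -(![![(0 : K), 1, 1, 1], ![-1, 0, 1, 1], ![-1, -1, 0, 1], ![-1, -1, -1, 0]] b' b) := by
    intro b b'
    fin_cases b <;> fin_cases b' <;> simp
  have ws0 : ∀ b : Fin 4,
      (![![(0 : K), 1, 1, 1], ![-1, 0, 1, 1], ![-1, -1, 0, 1], ![-1, -1, -1, 0]] b b) = 0 := by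
    intro b
    fin_cases b <;> simp
  have hGC : ∀ b k b' k' : Fin 4, G b k b' k' =
      (![![(0 : K), 1, 1, 1], ![-1, 0, 1, 1], ![-1, -1, 0, 1], ![-1, -1, -1, 0]] b b') *
      (![![(0 : K), 1, 1, 1], ![-1, 0, 1, 1], ![-1, -1, 0, 1], ![-1, -1, -1, 0]] k k') *
      C (![![(0 : Fin 6), 0, 1, 2], ![0, 0, 3, 4], ![1, 3, 0, 5], ![2, 4, 5, 0]] b b')
        (![![(0 : Fin 6), 0, 1, 2], ![0, 0, 3, 4], ![1, 3, 0, 5], ![2, 4, 5, 0]] k k') := by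
    intro b k b' k'
    rcases lt_trichotomy b b' with hb | rfl | hb
    · rcases lt_trichotomy k k' with hk | rfl | hk
      · rw [hC, wi1 _ _ hb, wi1 _ _ hk, wi2 _ _ hb, wi2 _ _ hk, ws1 _ _ hb, ws1 _ _ hk]; ring
      · rw [zk, ws0]; ring
      · rw [ak _ _ _ _ hk, hC, wiS k k', wi1 _ _ hb, wi1 _ _ hk, wi2 _ _ hb, wi2 _ _ hk, ws1 _ _ hb,
          wsA k k', ws1 _ _ hk]; ring
    · rw [zb, ws0]; ring
    · rcases lt_trichotomy k k' with hk | rfl | hk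
      · rw [ab _ _ _ _ hb, hC, wiS b b', wi1 _ _ hb, wi1 _ _ hk, wi2 _ _ hb, wi2 _ _ hk, wsA b b',
          ws1 _ _ hb, ws1 _ _ hk]; ring
      · rw [zk, ws0]; ring
      · rw [ab _ _ _ _ hb, ak _ _ _ _ hk, hC, wiS b b', wiS k k', wi1 _ _ hb, wi1 _ _ hk, wi2 _ _ hb,
          wi2 _ _ hk, wsA b b', wsA k k', ws1 _ _ hb, ws1 _ _ hk]; ring
  -- two summation tools for the certified exit
  have hlin : ∀ (ξ₀ : Fin 4 → Fin 4 → K) (y : ι → K),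
      ∑ r, c r * (∑ b, ∑ k, ξ₀ b k * n b k r) * y r = ∑ b, ∑ k, ξ₀ b k * ∑ r, c r * n b k r * y r := by
    intro ξ₀ y
    simp only [Finset.mul_sum, Finset.sum_mul]
    rw [Finset.sum_comm]
    refine Finset.sum_congr rfl fun b _ => ?_
    rw [Finset.sum_comm]
    exact Finset.sum_congr rfl fun k _ => Finset.sum_congr rfl fun r _ => by ring
  have sum_delta : ∀ (φ : Fin 4 → Fin 4 → K) (p q : Fin 4),
      ∑ b, ∑ k, ((if b = p then (1 : K) else 0) * (if k = q then (1 : K) else 0)) * φ b k = φ p q := by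
    intro φ p q
    fin_cases p <;> fin_cases q <;> simp
  -- run the abstract tree
  refine nuTree_0 C _ ?_ ?_ ?_ ?_ ?_
  · -- certified exit: three kernel functionals with an invertible `3 × 3` pairing block
    intro ρ κ N hN hdet
    set ξ : Fin 3 → Fin 4 → Fin 4 → K := fun i => Sum.elim
      (fun b₁ : Fin 4 => fun b k : Fin 4 => (if b = b₁ then (1 : K) else 0) * (if k = b₁ then (1 : K) else 0))
      (fun p : Fin 4 × Fin 4 => fun b k : Fin 4 =>
        (if b = p.1 then (1 : K) else 0) * (if k = p.2 then (1 : K) else 0) -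
        (if b = p.2 then (1 : K) else 0) * (if k = p.1 then (1 : K) else 0)) (ρ i) with hξ
    set g : Fin 3 → ι → K := fun j => n (κ j).1 (κ j).2 with hg
    refine Or.inl ⟨ξ, ?_, g, ?_⟩
    · intro i b k hbk
      simp only [hξ]
      generalize ρ i = l
      rcases l with b₁ | ⟨p, q⟩
      · simp only [Sum.elim_inl]
        by_cases h : b = b₁
        · have hk : k ≠ b₁ := fun hk => hbk (h.trans hk.symm)
          simp [h, hk]
        · simp [h]
      · simp only [Sum.elim_inr]
        ring
    · have hM : (Matrix.of fun i i' : Fin 3 =>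
          ∑ r, c r * (∑ b, ∑ k, ξ i b k * n b k r) * g i' r) = N := by
        ext i j
        rw [Matrix.of_apply, ← hN i j, hlin]
        simp only [hξ, hg, hG]
        generalize ρ i = l
        rcases l with b₁ | ⟨p, q⟩
        · simp only [Sum.elim_inl]
          rw [sum_delta (fun b k => G b k (κ j).1 (κ j).2), hGC]
        · simp only [Sum.elim_inr, sub_mul, Finset.sum_sub_distrib]
          rw [sum_delta (fun b k => G b k (κ j).1 (κ j).2),
            sum_delta (fun b k => G b k (κ j).1 (κ j).2), hGC, hGC]
      rw [hM]
      exact hdet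
  · intro h0
    exact Or.inr (Or.inl fun b k b' k' => by rw [hGC, h0, mul_zero])
  · intro τ hτ hτC
    exact Or.inr (Or.inr ⟨τ, hτ, _, Or.inl rfl, fun b k b' k' => by rw [hGC, hτC]; ring⟩)
  · intro τ hτ hτC
    exact Or.inr (Or.inr ⟨τ, hτ, _, Or.inr (Or.inl rfl), fun b k b' k' => by rw [hGC, hτC]; ring⟩)
  · intro τ hτ hτC
    exact Or.inr (Or.inr ⟨τ, hτ, _, Or.inr (Or.inr rfl), fun b k b' k' => by rw [hGC, hτC]; ring⟩)

/-- **The `μ`-side trichotomy**: `nu_side_trichotomy` for the transposed design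
`t'((a,b),(y₂,y₃)) = t((b,a),(y₃,y₂))`, i.e. the same three exits for the vectors
`m_{al} = (t_r((e_a,0),(0,e_l)))_r` (the `μ`-half of `…PureGramCount.false_of_allX_of_kernel_three_three`,
resp. `…false_of_allX_of_mGram_zero`). [folklore] -/
theorem mu_side_trichotomy (c : ι → K)
    (t : ι → (((Fin 4 → K) × (Fin 4 → K)) →ₗ[K] ((Fin 4 → K) × (Fin 4 → K)) →ₗ[K] K))
    (hJ : ∀ a b y₂ y₃ : Fin 4 → K,
      ∑ r, c r * (t r (a, b) (y₂, y₃)) ^ 2 = (Matrix.of ![a, b, y₂, y₃]).permanent) :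
    (∃ η : Fin 3 → Fin 4 → Fin 4 → K, (∀ j a l, a ≠ l → η j a l = -η j l a) ∧
      ∃ h : Fin 3 → ι → K, (Matrix.of fun j j' : Fin 3 => ∑ r, c r *
        (∑ a, ∑ l, η j a l * t r (Pi.single a 1, 0) (0, Pi.single l 1)) * h j' r).det ≠ 0) ∨
    (∀ a l a' l' : Fin 4, ∑ r, c r * t r (Pi.single a 1, 0) (0, Pi.single l 1) *
        t r (Pi.single a' 1, 0) (0, Pi.single l' 1) = 0) ∨
    (∃ τ : K, τ ≠ 0 ∧ ∃ M : Matrix (Fin 6) (Fin 6) K,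
      (M = !![0, 0, 0, 0, 0, 1; 0, 0, 0, 0, 1, 0; 0, 0, 0, 1, 0, 0; 0, 0, 1, 0, 0, 0; 0, 1, 0, 0, 0, 0;
          1, 0, 0, 0, 0, 0] ∨
       M = !![0, 0, 0, 0, 0, 1; 0, 0, 0, 0, 1, 0; 0, 0, 0, -1, 0, 0; 0, 0, -1, 0, 0, 0; 0, 1, 0, 0, 0, 0;
          1, 0, 0, 0, 0, 0] ∨
       M = !![0, 0, 0, 0, 0, 1; 0, 0, 0, 0, -1, 0; 0, 0, 0, -1, 0, 0; 0, 0, -1, 0, 0, 0; 0, -1, 0, 0, 0, 0;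
          1, 0, 0, 0, 0, 0]) ∧
      ∀ a l a' l' : Fin 4, ∑ r, c r * t r (Pi.single a 1, 0) (0, Pi.single l 1) *
          t r (Pi.single a' 1, 0) (0, Pi.single l' 1) =
        τ * ((![![(0 : K), 1, 1, 1], ![-1, 0, 1, 1], ![-1, -1, 0, 1], ![-1, -1, -1, 0]] a a') *
          (![![(0 : K), 1, 1, 1], ![-1, 0, 1, 1], ![-1, -1, 0, 1], ![-1, -1, -1, 0]] l l') *
          M (![![(0 : Fin 6), 0, 1, 2], ![0, 0, 3, 4], ![1, 3, 0, 5], ![2, 4, 5, 0]] a a')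
            (![![(0 : Fin 6), 0, 1, 2], ![0, 0, 3, 4], ![1, 3, 0, 5], ![2, 4, 5, 0]] l l'))) := by
  -- the transposed design (swap the roles of `(a, y₃)` and `(b, y₂)`) satisfies the same identity
  let sw : ((Fin 4 → K) × (Fin 4 → K)) →ₗ[K] ((Fin 4 → K) × (Fin 4 → K)) :=
    { toFun := fun u => (u.2, u.1)
      map_add' := fun u v => rfl
      map_smul' := fun s u => rfl }
  let t' : ι → (((Fin 4 → K) × (Fin 4 → K)) →ₗ[K] ((Fin 4 → K) × (Fin 4 → K)) →ₗ[K] K) :=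
    fun r => ((t r).comp sw).compl₂ sw
  have ht' : ∀ r (a b y₂ y₃ : Fin 4 → K), t' r (a, b) (y₂, y₃) = t r (b, a) (y₃, y₂) :=
    fun r a b y₂ y₃ => rfl
  have hJ' : ∀ a b y₂ y₃ : Fin 4 → K,
      ∑ r, c r * (t' r (a, b) (y₂, y₃)) ^ 2 = (Matrix.of ![a, b, y₂, y₃]).permanent := by
    intro a b y₂ y₃
    simp_rw [ht']
    rw [hJ b a y₃ y₂, per_swap_row₀₁, per_swap_row₂₃]
  have h := nu_side_trichotomy c t' hJ'
  simp only [ht'] at h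
  exact h

end Summit.ValiantsHypothesis.ValiantsHypothesis.Theorems.SymPencilPerFourInnerRankPureGramNuSide

end
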